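import Literature.Computability.Complexity.CountingReductions
import HarnessLib

/-!
# The not-all-equal normal form of Lemma 3 of Liśkiewicz–Ogihara–Toda 2003 and the counting
# problem `#3SAT` restricted to it

Counting complexity, continuing `CountingReductions.lean` (`ParsimoniousReducible`, `SHARP3SAT`,
`CNF.numSat`, Proposition 2 of LOT2003 as the named fact `Valiant1979_sharpSAT_parsimonious`).
Source followed: M. Liśkiewicz, M. Ogihara, S. Toda, *The complexity of counting self-avoiding
walks in subgraphs of two-dimensional grids and hypercubes*, TCS 304 (2003), §2.3 (held:
`paper:doi-10-1016-s0304-3975-03-00080-x`, p. 8):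

* "For a CNF formula `φ` and its satisfying assignment `α`, we say that `α` is a not-all-equal
  satisfying assignment of `φ` if for every clause `C` of `φ` with more than one literal it holds
  that `α` falsifies at least one literal of `C`."
* **Lemma 3.** "There is a polynomial time computable function `f` that maps each 3CNF formula to
  a 3̄CNF formula such that, for all integers `n, m ≥ 1` and for all formulas `φ` of `n` variables
  and `m` clauses, `ψ = f(φ)` has the following properties: (1) The number of variables of `ψ` is
  `n + m + 1` and the number of clauses of `ψ` is `8m + 1`. Of the `8m + 1` clauses only one is a
  single-literal clause and the rest are three-literal clauses. (2) Every satisfying assignment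
  `α` of `ψ` is a not-all-equal satisfying assignment. More precisely, for every satisfying
  assignment `α` of `ψ`, `α` satisfies exactly two literals for exactly `4m` three-literal clauses
  and satisfies exactly one literal for exactly `4m` three-literal clauses." Proof: a new variable
  `w` with the single-literal clause `(¬w)`; for the `i`-th clause `(x ∨ y ∨ z)` a new variable
  `uᵢ` forced to `x ∨ y` by three clauses, padded with the literal `w` to three literals, giving
  four three-literal clauses, "So, we add the literal-wise complement of each of the four clauses
  … for all three-literal clauses `D`, for all assignments `α`, and for all integers `k`,
  `0 ≤ k ≤ 2` [sic; `≤ 3`], `α` satisfies exactly `k` literals of `D` if and only if `α` satisfies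
  exactly `3 − k` literals of the literal-wise complement of `D`"; "Clearly, the number of
  satisfying assignments of `ψ` is equal to that of `φ`."

## What is here

* `Clause.complement` (literal-wise complement), `Clause.trueCount σ c` (number of satisfied
  literals), `trueCount_add_trueCount_complement` (the `k ↔ 3 − k` remark);
* the SYNTACTIC normal form `CNF.IsLOTNormalForm ψ`: `ψ` is a single-literal clause followed by
  consecutive complementary pairs `D, D̄` of three-literal clauses (`CNF.IsComplPairs`); decidable.
  This is the shape of the range of Lemma 3's map (the map itself, `CNF.lemma3Map`, with
  properties (1), (2) and the equality of the numbers of satisfying assignments PROVED, is the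
  sibling file `SharpSATNormalFormMap.lean`);
* **property (2) PROVED for every formula in normal form** (`IsComplPairs.trueCount_eq_one_or_two`,
  `IsComplPairs.two_mul_countP_trueCount_eq`): under a satisfying assignment every three-literal
  clause has one or two true literals, and exactly half of the three-literal clauses (counted with
  their list positions) have two;
* the counting function `SHARP3SATNF := cnfCountFn IsLOTNormalForm` (`#3SAT` restricted to
  normal-form instances, `0` elsewhere) — the source of the gadget reduction of Lemma 4;
* named facts: `LOT2003_prop2_sharp3SAT` (the conjunct of Proposition 2 that Lemma 4 consumes:
  every `#P` function is parsimoniously reducible to `#3SAT`; a corollary of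
  `Valiant1979_sharpSAT_parsimonious`, `LOT2003_prop2_sharp3SAT_of_valiant`) and `LOT2003_lemma3`
  (the string-level parsimonious reduction `#3SAT ≤ᵖ_pars SHARP3SATNF`; its combinatorial content
  is proved in the sibling file, the missing piece is the polynomial-time machine for the map on
  codes).

## Design notes

* The normal form is cut out syntactically (complementary pairs) rather than by property (2)
  itself, so that membership is a polynomial-time check and the counting function is an honest
  promise-free problem; property (2) is then a theorem. The class contains the range of Lemma 3's
  map and the printed counting argument of Lemma 4 (§3) uses of `ψ` exactly: one single-literal
  clause, three-literal clauses otherwise, and property (2).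
* The single-literal clause is placed FIRST in the list (the source does not fix an order of
  clauses; `numSat` is order-independent).

## References

* M. Liśkiewicz, M. Ogihara, S. Toda, TCS 304 (2003) 129–156, §2.3, Lemma 3; §3 (use in Lemma 4).
* L. G. Valiant, *The complexity of enumeration and reliability problems*, SIAM J. Comput. 8 (1979)
  410–421 (Proposition 2 of LOT2003).
* T. J. Schaefer, *The complexity of satisfiability problems*, STOC 1978 (NAE3SAT; the paper's [21]).
-/

namespace Literature.Computability.Complexity

open _root_.Computability

universe u

variable {ν : Type u}

/-! ### Satisfied-literal counts and literal-wise complements -/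

namespace Clause

/-- The **literal-wise complement** `D̄` of a clause `D`: every literal negated.
[cite: LiskiewiczOgiharaToda2003, §2.3 (proof of Lemma 3)] -/
def complement (c : Clause ν) : Clause ν :=
  c.map Literal.negate

/-- The complement has the same number of literals. [cite: LiskiewiczOgiharaToda2003, §2.3] -/
@[simp] theorem length_complement (c : Clause ν) : c.complement.length = c.length :=
  List.length_map _

/-- Membership in the complement. [folklore] -/
theorem mem_complement {c : Clause ν} {l : Literal ν} :
    l ∈ c.complement ↔ ∃ l' ∈ c, l'.negate = l :=
  List.mem_map

/-- The number of literals of the clause `c` satisfied by `σ` ("`α` satisfies exactly `k` literals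
of `D`"). [cite: LiskiewiczOgiharaToda2003, §2.3 (Lemma 3 (2))] -/
def trueCount (σ : ν → Bool) (c : Clause ν) : ℕ :=
  c.countP fun l => l.eval σ

/-- A clause is satisfied iff at least one of its literals is. [folklore] -/
theorem eval_eq_true_iff_trueCount_pos (σ : ν → Bool) (c : Clause ν) :
    c.eval σ = true ↔ 0 < c.trueCount σ := by
  simp [Clause.eval, trueCount, List.any_eq_true, List.countP_pos_iff]

/-- At most `|c|` literals are satisfied. [folklore] -/
theorem trueCount_le_length (σ : ν → Bool) (c : Clause ν) : c.trueCount σ ≤ c.length :=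
  List.countP_le_length

/-- **The complement remark of Lemma 3**: `α` satisfies exactly `k` literals of `D` iff it
satisfies exactly `|D| − k` literals of `D̄` — stated additively.
[cite: LiskiewiczOgiharaToda2003, §2.3 (proof of Lemma 3)] -/
theorem trueCount_add_trueCount_complement (σ : ν → Bool) (c : Clause ν) :
    c.trueCount σ + c.complement.trueCount σ = c.length := by
  unfold trueCount complement
  rw [List.countP_map, List.length_eq_countP_add_countP (fun l => Literal.eval σ l) (l := c)]
  congr 1
  refine List.countP_congr fun l _ => ?_
  simp [Function.comp]

end Clause

/-! ### The normal form: a single-literal clause and complementary pairs of three-literal clauses -/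

namespace CNF

/-- `ψ` is a list of consecutive **complementary pairs** `D, D̄` of three-literal clauses (the
three-literal part of Lemma 3's `ψ = (¬w) ∧ ⋀ᵢ (D_{i,1} ∧ D̄_{i,1} ∧ ⋯ ∧ D_{i,4} ∧ D̄_{i,4})`).
[cite: LiskiewiczOgiharaToda2003, §2.3 (proof of Lemma 3: "we add the literal-wise complement of each of the four clauses")] -/
def IsComplPairs : CNF ν → Prop
  | [] => True
  | [_] => False
  | D :: D' :: rest => D.length = 3 ∧ D' = Clause.complement D ∧ IsComplPairs rest

/-- **The normal form of Lemma 3** (syntactic form): one single-literal clause followed by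
complementary pairs of three-literal clauses. Every formula in the range of Lemma 3's map has
this shape (`SharpSATNormalFormMap.lean`), and every formula of this shape has property (2) of
Lemma 3 (`IsLOTNormalForm.two_mul_countP_trueCount_eq`).
[cite: LiskiewiczOgiharaToda2003, Lemma 3 (1)–(2)] -/
def IsLOTNormalForm : CNF ν → Prop
  | [_] :: rest => IsComplPairs rest
  | _ => False

/-- Decidability of `IsComplPairs` (a syntactic check). [folklore] -/
instance instDecidableIsComplPairs [DecidableEq ν] : ∀ ψ : CNF ν, Decidable (IsComplPairs ψ)
  | [] => inferInstanceAs (Decidable True)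
  | [_] => inferInstanceAs (Decidable False)
  | D :: D' :: rest =>
    haveI := instDecidableIsComplPairs rest
    inferInstanceAs (Decidable (D.length = 3 ∧ D' = Clause.complement D ∧ IsComplPairs rest))

/-- Decidability of `IsLOTNormalForm` (a syntactic check). [folklore] -/
instance instDecidableIsLOTNormalForm [DecidableEq ν] : ∀ ψ : CNF ν, Decidable (IsLOTNormalForm ψ)
  | [] => inferInstanceAs (Decidable False)
  | [] :: _ => inferInstanceAs (Decidable False)
  | [_] :: rest => inferInstanceAs (Decidable (IsComplPairs rest))
  | (_ :: _ :: _) :: _ => inferInstanceAs (Decidable False)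

/-- Unfolding `IsComplPairs` on a pair. [folklore] -/
@[simp] theorem isComplPairs_cons_cons (D D' : Clause ν) (rest : CNF ν) :
    IsComplPairs (D :: D' :: rest) ↔ D.length = 3 ∧ D' = Clause.complement D ∧ IsComplPairs rest :=
  Iff.rfl

/-- The empty list is (vacuously) a list of complementary pairs. [folklore] -/
@[simp] theorem isComplPairs_nil : IsComplPairs ([] : CNF ν) := trivial

/-- A single clause is not a list of complementary pairs. [folklore] -/
@[simp] theorem not_isComplPairs_singleton (D : Clause ν) : ¬ IsComplPairs [D] := id

/-- Unfolding `IsLOTNormalForm`. [folklore] -/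
@[simp] theorem isLOTNormalForm_cons_singleton (l : Literal ν) (rest : CNF ν) :
    IsLOTNormalForm ([l] :: rest) ↔ IsComplPairs rest :=
  Iff.rfl

/-- A formula in normal form, destructured. [cite: LiskiewiczOgiharaToda2003, Lemma 3 (1)] -/
theorem IsLOTNormalForm.exists_eq {ψ : CNF ν} (h : IsLOTNormalForm ψ) :
    ∃ l rest, ψ = [l] :: rest ∧ IsComplPairs rest := by
  match ψ, h with
  | [l] :: rest, h => exact ⟨l, rest, rfl, h⟩

/-- Complementary pairs concatenate. [folklore] -/
theorem IsComplPairs.append : ∀ {A B : CNF ν}, IsComplPairs A → IsComplPairs B → IsComplPairs (A ++ B)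
  | [], _, _, hB => hB
  | [_], _, hA, _ => hA.elim
  | _ :: _ :: _, _, ⟨hD, hD', hrest⟩, hB => ⟨hD, hD', hrest.append hB⟩

/-- A concatenation of lists of complementary pairs is one. [folklore] -/
theorem isComplPairs_flatten {L : List (CNF ν)} (h : ∀ B ∈ L, IsComplPairs B) :
    IsComplPairs L.flatten := by
  induction L with
  | nil => exact isComplPairs_nil
  | cons B L ih =>
    rw [List.flatten_cons]
    exact (h B (by simp)).append (ih fun B' hB' => h B' (by simp [hB']))

/-- The number of three-literal clauses of a list of complementary pairs is even.
[cite: LiskiewiczOgiharaToda2003, Lemma 3 (1)] -/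
theorem IsComplPairs.even_length : ∀ {ψ : CNF ν}, IsComplPairs ψ → Even ψ.length
  | [], _ => ⟨0, rfl⟩
  | [_], h => h.elim
  | _ :: _ :: rest, ⟨_, _, hrest⟩ => by
    obtain ⟨k, hk⟩ := IsComplPairs.even_length (ψ := rest) hrest
    exact ⟨k + 1, by simp [hk]; omega⟩

/-- Every clause of a list of complementary pairs has exactly three literals ("the rest are
three-literal clauses"). [cite: LiskiewiczOgiharaToda2003, Lemma 3 (1)] -/
theorem IsComplPairs.length_eq_three : ∀ {ψ : CNF ν}, IsComplPairs ψ → ∀ c ∈ ψ, c.length = 3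
  | [], _, c, hc => by simp at hc
  | [_], h, _, _ => h.elim
  | D :: D' :: rest, ⟨hD, hD', hrest⟩, c, hc => by
    simp only [List.mem_cons] at hc
    rcases hc with rfl | rfl | hc
    · exact hD
    · rw [hD', Clause.length_complement, hD]
    · exact hrest.length_eq_three c hc

/-! ### Property (2): satisfying assignments are not-all-equal, half the clauses doubly satisfied -/

/-- **Lemma 3 (2), first half, for complementary pairs**: under an assignment satisfying every
clause, each clause has exactly one or exactly two true literals (so the assignment is
not-all-equal). [cite: LiskiewiczOgiharaToda2003, Lemma 3 (2)] -/
theorem IsComplPairs.trueCount_eq_one_or_two (σ : ν → Bool) :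
    ∀ {ψ : CNF ν}, IsComplPairs ψ → (∀ c ∈ ψ, c.eval σ = true) →
      ∀ c ∈ ψ, c.trueCount σ = 1 ∨ c.trueCount σ = 2
  | [], _, _, c, hc => by simp at hc
  | [_], h, _, _, _ => h.elim
  | D :: D' :: rest, ⟨hD, hD', hrest⟩, hsat, c, hc => by
    have h1 : 0 < D.trueCount σ :=
      (Clause.eval_eq_true_iff_trueCount_pos σ D).1 (hsat D (by simp))
    have h2 : 0 < D'.trueCount σ :=
      (Clause.eval_eq_true_iff_trueCount_pos σ D').1 (hsat D' (by simp))
    have hsum := Clause.trueCount_add_trueCount_complement σ D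
    rw [← hD', hD] at hsum
    simp only [List.mem_cons] at hc
    rcases hc with rfl | rfl | hc
    · omega
    · omega
    · exact hrest.trueCount_eq_one_or_two σ (fun c' hc' => hsat c' (by simp [hc'])) c hc

/-- **Lemma 3 (2), second half, for complementary pairs**: under an assignment satisfying every
clause, exactly half of the clauses (with their list positions) have exactly two true literals —
"`α` satisfies exactly two literals for exactly `4m` three-literal clauses and satisfies exactly
one literal for exactly `4m` three-literal clauses" when there are `8m` of them.
[cite: LiskiewiczOgiharaToda2003, Lemma 3 (2)] -/
theorem IsComplPairs.two_mul_countP_trueCount_eq (σ : ν → Bool) :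
    ∀ {ψ : CNF ν}, IsComplPairs ψ → (∀ c ∈ ψ, c.eval σ = true) →
      2 * ψ.countP (fun c => c.trueCount σ = 2) = ψ.length ∧
        2 * ψ.countP (fun c => c.trueCount σ = 1) = ψ.length
  | [], _, _ => by simp
  | [_], h, _ => h.elim
  | D :: D' :: rest, ⟨hD, hD', hrest⟩, hsat => by
    have h1 : 0 < D.trueCount σ :=
      (Clause.eval_eq_true_iff_trueCount_pos σ D).1 (hsat D (by simp))
    have h2 : 0 < D'.trueCount σ :=
      (Clause.eval_eq_true_iff_trueCount_pos σ D').1 (hsat D' (by simp))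
    have hsum := Clause.trueCount_add_trueCount_complement σ D
    rw [← hD', hD] at hsum
    obtain ⟨ih2, ih1⟩ :=
      hrest.two_mul_countP_trueCount_eq σ (fun c' hc' => hsat c' (by simp [hc']))
    simp only [List.countP_cons, List.length_cons, decide_eq_true_eq]
    constructor
    · rcases Nat.lt_or_ge (D.trueCount σ) 2 with hlt | hge
      · have hDc : ¬ D.trueCount σ = 2 := by omega
        have hD'c : D'.trueCount σ = 2 := by omega
        simp only [hDc, hD'c, if_false, if_true]
        omega
      · have hDc : D.trueCount σ = 2 := by omega
        have hD'c : ¬ D'.trueCount σ = 2 := by omega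
        simp only [hDc, hD'c, if_false, if_true]
        omega
    · rcases Nat.lt_or_ge (D.trueCount σ) 2 with hlt | hge
      · have hDc : D.trueCount σ = 1 := by omega
        have hD'c : ¬ D'.trueCount σ = 1 := by omega
        simp only [hDc, hD'c, if_false, if_true]
        omega
      · have hDc : ¬ D.trueCount σ = 1 := by omega
        have hD'c : D'.trueCount σ = 1 := by omega
        simp only [hDc, hD'c, if_false, if_true]
        omega

/-- **Lemma 3 (2) for formulas in normal form**: every satisfying assignment of `ψ = [ℓ] :: rest`
is not-all-equal on the three-literal clauses, exactly half of which have two true literals and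
half exactly one. [cite: LiskiewiczOgiharaToda2003, Lemma 3 (2)] -/
theorem IsLOTNormalForm.two_mul_countP_trueCount_eq {l : Literal ν} {rest : CNF ν}
    (h : IsLOTNormalForm ([l] :: rest)) {σ : ν → Bool}
    (hsat : CNF.eval ([l] :: rest) σ = true) :
    (∀ c ∈ rest, c.trueCount σ = 1 ∨ c.trueCount σ = 2) ∧
      2 * rest.countP (fun c => c.trueCount σ = 2) = rest.length ∧
        2 * rest.countP (fun c => c.trueCount σ = 1) = rest.length := by
  rw [isLOTNormalForm_cons_singleton] at h
  have hsat' : ∀ c ∈ rest, c.eval σ = true := fun c hc =>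
    (eval_eq_true_iff _ σ).1 hsat c (List.mem_cons_of_mem _ hc)
  exact ⟨h.trueCount_eq_one_or_two σ hsat', h.two_mul_countP_trueCount_eq σ hsat'⟩

/-- Sanity check (by `decide`): `(¬x₀) ∧ (x₁ ∨ x₂ ∨ ¬x₃) ∧ (¬x₁ ∨ ¬x₂ ∨ x₃)` is in normal form;
the empty formula, a formula whose first clause is not a single literal, and an unpaired
three-literal clause are not. [folklore] -/
theorem isLOTNormalForm_examples :
    IsLOTNormalForm [[(0, false)], [(1, true), (2, true), (3, false)],
        [(1, false), (2, false), (3, true)]] ∧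
      ¬ IsLOTNormalForm ([] : CNF ℕ) ∧ ¬ IsLOTNormalForm [[(0, false), (1, true)]] ∧
        ¬ IsLOTNormalForm [[(0, false)], [(1, true), (2, true), (3, false)]] := by
  decide

end CNF

/-! ### The counting problem on normal-form instances and the named facts around Lemma 3 -/

/-- **`SHARP3SATNF : {0,1}* → ℕ`** — `#3SAT` restricted to the normal form of Lemma 3: on the code
(`encodingCNF`) of a formula `ψ` in normal form (`CNF.IsLOTNormalForm`), the number of satisfying
assignments of `ψ`; `0` on all other strings. The counting problem from which the gadget graph of
Lemma 4 is built ("Let `ψ` be the formula generated from `φ` by applying the transformation in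
Lemma 3 … We construct a graph `G` from `ψ`"). [cite: LiskiewiczOgiharaToda2003, Lemma 3 and §3 (proof of Lemma 4)] -/
def SHARP3SATNF : List Bool → ℕ :=
  cnfCountFn CNF.IsLOTNormalForm

/-- `SHARP3SATNF` on the code of a normal-form formula is its number of satisfying assignments.
[cite: LiskiewiczOgiharaToda2003, Lemma 3] -/
theorem SHARP3SATNF_encode {ψ : CNF ℕ} (h : CNF.IsLOTNormalForm ψ) :
    SHARP3SATNF (encodingCNF.encode ψ) = ψ.numSat := by
  simp [SHARP3SATNF, cnfCountFn_encode, h]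

/-- `SHARP3SATNF` vanishes on codes of formulas not in normal form. [cite: LiskiewiczOgiharaToda2003, Lemma 3] -/
theorem SHARP3SATNF_encode_of_not {ψ : CNF ℕ} (h : ¬ CNF.IsLOTNormalForm ψ) :
    SHARP3SATNF (encodingCNF.encode ψ) = 0 := by
  simp [SHARP3SATNF, cnfCountFn_encode, h]

/-- **Proposition 2 of LOT2003, the conjunct consumed by Lemma 4** (Valiant 1979): every `#P`
function is polynomial-time parsimoniously reducible to `#3SAT` (`SHARP3SAT`: formulas whose
clauses have exactly three literals, over `encodingCNF`, counted by `CNF.numSat`). Weaker than the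
printed Proposition 2 (completeness of `#SAT`, `#3SAT`, `#3̄SAT`), of which it is a corollary
(`LOT2003_prop2_sharp3SAT_of_valiant`); named apart so that the parsimonious Cook–Levin theorem
for `#3SAT` can be discharged on its own. Named fact, not proved here.
[cite: LiskiewiczOgiharaToda2003, Proposition 2] -/
def LOT2003_prop2_sharp3SAT : Prop :=
  ∀ f ∈ SharpP, ParsimoniousReducible f SHARP3SAT

/-- `LOT2003_prop2_sharp3SAT` is a corollary of the tree's named Proposition 2.
[cite: LiskiewiczOgiharaToda2003, Proposition 2] -/
theorem LOT2003_prop2_sharp3SAT_of_valiant (h : Valiant1979_sharpSAT_parsimonious) :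
    LOT2003_prop2_sharp3SAT :=
  fun _ hf => h.sharp3SAT_hard hf

/-- **Lemma 3 of LOT2003 as a reduction between counting functions**: `#3SAT` is polynomial-time
parsimoniously reducible to `#3SAT` on normal-form instances (`SHARP3SATNF`) — on codes of 3CNF
formulas the map is `φ ↦ f(φ)` of Lemma 3 (the tree's `CNF.lemma3Map`, whose count preservation
`CNF.numSat_lemma3Map` and normal form `CNF.isLOTNormalForm_lemma3Map` are proved in
`SharpSATNormalFormMap.lean`); other strings go to a fixed instance with count `0`. Named fact:
the missing piece is the polynomial-time machine computing the map on codes.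
[cite: LiskiewiczOgiharaToda2003, Lemma 3] -/
def LOT2003_lemma3 : Prop :=
  ParsimoniousReducible SHARP3SAT SHARP3SATNF

end Literature.Computability.Complexity
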